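import Summits.QuantumFields.QCD.Theses.HeatSlicedQuarks

/-!
# Stub `stub_latticeSum` of line `Sketch` (idea `drop-the-wilson-square`)
(crux `Summit.QuantumFields.QCD.Theses.HeatSlicedQuarks.ActionBoundsLowModes`, item stmt-QuantumFields-8872,
route route-QuantumFields-HeatSlicedQuarks)

**The `d = 4` momentum sum with doublers.**  For the symbol `σ(k) = Σ_μ 4 sin²(2π k_μ / L)` of the
naive (doubled-link) lattice kinetic operator on the four-torus `(ℤ/L)⁴` we prove, uniformly in `L ≥ 1`
and `ε > 0`,

  `L⁻⁴ Σ_{k ∈ (ℤ/L)⁴} (σ(k) + ε)⁻⁴ ≤ 2048 · (ε⁻² + ε⁻⁴ L⁻⁴)`.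

Proof (elementary, separable).
* AM–GM: with `b_μ := 4 sin²(2π k_μ/L) + ε/4 > 0` one has `Σ_μ b_μ = σ(k) + ε` and
  `(Σ_μ b_μ)⁴ ≥ 256 Π_μ b_μ`, so the sum is `≤ J⁴ / (256 L⁴)` with the one-dimensional
  `J := Σ_{a ∈ ℤ/L} (4 sin²(2π a/L) + ε/4)⁻¹` (`Fintype.sum_pow`).
* Jordan: `sin²(2π a.val/L) = sin²(π w/L)` with `w = (a + a).val ≡ 2 a.val (mod L)`, and for the centred
  representative `m = valMinAbs (a + a)` Kober's inequality `cos x ≤ 1 − (2/π²) x²` (`|x| ≤ π`) gives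
  `4 sin²(π w / L) ≥ 16 m² / L²`; hence `(4 sin²(2π a/L) + ε/4)⁻¹ ≤ h(|m|)` with
  `h(j) := (16 j²/L² + ε/4)⁻¹`.
* Fibres: `a.val ∈ {j/2, (j+L)/2, (L−j)/2, (2L−j)/2}` whenever `|m(a)| = j`, so each fibre of
  `a ↦ |m(a)| ∈ {0,…,L/2}` has at most `4` elements and `J ≤ 4 Σ_{j=0}^{L/2} h(j) = 16/ε + 4 Σ_{j=1}^{L/2} h(j)`.
* One-dimensional sum: `Σ_{1 ≤ j < N} (j² + s²)⁻¹ ≤ 3/s` for `s > 0` (split at `⌊s⌋`: the head has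
  `≤ s` terms each `≤ s⁻²`, the tail is `≤ Σ_{j > ⌊s⌋} j⁻² ≤ 2/(⌊s⌋+1) ≤ 2/s` by Mathlib's
  `sum_Ioo_inv_sq_le`).  With `s = L√ε/8` this gives `Σ_{j=1}^{L/2} h(j) ≤ 3L/(2√ε)`, so
  `J ≤ 16/ε + 6L/√ε`.
* Assembly: `(P + Q)⁴ ≤ 8(P⁴ + Q⁴)` with `P = 16/ε`, `Q = 6L/√ε` gives
  `J⁴/(256 L⁴) ≤ 2048/(ε⁴L⁴) + (81/2)/ε² ≤ 2048 (ε⁻² + ε⁻⁴L⁻⁴)`.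

Pure theorem file (no definitions); leans on Mathlib only (the Jordan lemma is adapted from the tree's
`SpectralDefectExtinctionTipNoBindingStubGreenBound`).
-/

namespace Summit.QuantumFields.QCD.Cruxes.ActionBoundsLowModes.DropTheWilsonSquare

open Literature.MathematicalPhysics Literature.MathematicalPhysics.QuantumLattice
  Literature.MathematicalPhysics.QuantumFieldTheory Literature.Probability.LatticeModels
open Matrix
open scoped Kronecker ComplexOrder

/-! ### AM–GM separability and the quartic binomial bound -/

/-- AM–GM for four positive reals in reciprocal form:
`1/(t₀+t₁+t₂+t₃+ε)⁴ ≤ (1/256) Π_μ 1/(t_μ + ε/4)`. -/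
private theorem latticeSum_amgm (t₀ t₁ t₂ t₃ ε : ℝ) (h₀ : 0 ≤ t₀) (h₁ : 0 ≤ t₁) (h₂ : 0 ≤ t₂)
    (h₃ : 0 ≤ t₃) (hε : 0 < ε) :
    1 / (t₀ + t₁ + t₂ + t₃ + ε) ^ 4 ≤
      1 / 256 * (1 / (t₀ + ε / 4) * (1 / (t₁ + ε / 4)) * (1 / (t₂ + ε / 4)) * (1 / (t₃ + ε / 4))) := by
  have key : ∀ a b c d : ℝ, 0 < a → 0 < b → 0 < c → 0 < d →
      256 * (a * b * c * d) ≤ (a + b + c + d) ^ 4 := by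
    intro a b c d ha hb hc hd
    have h1 : 4 * (a * b) ≤ (a + b) ^ 2 := by nlinarith [sq_nonneg (a - b)]
    have h2 : 4 * (c * d) ≤ (c + d) ^ 2 := by nlinarith [sq_nonneg (c - d)]
    have h3 : 4 * ((a + b) * (c + d)) ≤ (a + b + c + d) ^ 2 := by
      nlinarith [sq_nonneg (a + b - (c + d))]
    have h12 : 16 * (a * b * c * d) ≤ ((a + b) * (c + d)) ^ 2 :=
      calc 16 * (a * b * c * d) = (4 * (a * b)) * (4 * (c * d)) := by ring
        _ ≤ (a + b) ^ 2 * (c + d) ^ 2 := mul_le_mul h1 h2 (by positivity) (by positivity)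
        _ = ((a + b) * (c + d)) ^ 2 := by ring
    have h33 : 16 * ((a + b) * (c + d)) ^ 2 ≤ (a + b + c + d) ^ 4 :=
      calc 16 * ((a + b) * (c + d)) ^ 2
          = (4 * ((a + b) * (c + d))) * (4 * ((a + b) * (c + d))) := by ring
        _ ≤ (a + b + c + d) ^ 2 * (a + b + c + d) ^ 2 :=
            mul_le_mul h3 h3 (by positivity) (by positivity)
        _ = (a + b + c + d) ^ 4 := by ring
    linarith
  have ha : 0 < t₀ + ε / 4 := by positivity
  have hb : 0 < t₁ + ε / 4 := by positivity
  have hc : 0 < t₂ + ε / 4 := by positivity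
  have hd : 0 < t₃ + ε / 4 := by positivity
  have hsum : t₀ + t₁ + t₂ + t₃ + ε = (t₀ + ε / 4) + (t₁ + ε / 4) + (t₂ + ε / 4) + (t₃ + ε / 4) := by
    ring
  rw [one_div_mul_one_div, one_div_mul_one_div, one_div_mul_one_div, one_div_mul_one_div, hsum]
  exact one_div_le_one_div_of_le (by positivity) (key _ _ _ _ ha hb hc hd)

/-- `(P + Q)⁴ ≤ 8 (P⁴ + Q⁴)` for all reals. -/
private theorem latticeSum_add_pow_four (P Q : ℝ) : (P + Q) ^ 4 ≤ 8 * (P ^ 4 + Q ^ 4) := by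
  have h1 : (P + Q) ^ 2 ≤ 2 * (P ^ 2 + Q ^ 2) := by nlinarith [sq_nonneg (P - Q)]
  have h2 : (P ^ 2 + Q ^ 2) ^ 2 ≤ 2 * (P ^ 4 + Q ^ 4) := by nlinarith [sq_nonneg (P ^ 2 - Q ^ 2)]
  calc (P + Q) ^ 4 = ((P + Q) ^ 2) ^ 2 := by ring
    _ ≤ (2 * (P ^ 2 + Q ^ 2)) ^ 2 := pow_le_pow_left₀ (sq_nonneg _) h1 2
    _ = 4 * (P ^ 2 + Q ^ 2) ^ 2 := by ring
    _ ≤ 8 * (P ^ 4 + Q ^ 4) := by linarith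

/-! ### Jordan's inequality per coordinate (adapted from the `GreenBound` stub of `TipNoBinding`) -/

/-- `cos(2π a.val / L) = cos(2π m / L)` for the centred representative `m = valMinAbs a`
(`a.val = m` or `a.val = m + L`). -/
private theorem latticeSum_cos_two_pi_val_div (L : ℕ) [NeZero L] (a : ZMod L) :
    Real.cos (2 * Real.pi * (a.val : ℝ) / L) = Real.cos (2 * Real.pi / L * (a.valMinAbs : ℝ)) := by
  -- adapted from SpectralDefectExtinctionTipNoBindingStubGreenBound (greenBound_cos_two_pi_val_div)
  have hL : (L : ℝ) ≠ 0 := by exact_mod_cast NeZero.ne L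
  have hv := ZMod.val_eq_ite_valMinAbs a
  split_ifs at hv with hc
  · have hv2 : (a.val : ℤ) = a.valMinAbs := by simpa using hv
    have hv' : (a.val : ℝ) = (a.valMinAbs : ℝ) := by exact_mod_cast hv2
    rw [hv']
    ring_nf
  · have hv' : (a.val : ℝ) = (a.valMinAbs : ℝ) + L := by exact_mod_cast hv
    rw [hv', show 2 * Real.pi * ((a.valMinAbs : ℝ) + L) / L =
      2 * Real.pi / L * (a.valMinAbs : ℝ) + 2 * Real.pi by field_simp, Real.cos_add_two_pi]

/-- **Jordan's bound per coordinate**: `16 m² / L² ≤ 4 sin²(π a.val / L)`, `m = valMinAbs a`,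
because `4 sin²(π a.val / L) = 2(1 − cos(2π m / L))`, `|2π m / L| ≤ π` and
`cos x ≤ 1 − (2/π²) x²` there. -/
private theorem latticeSum_jordan (L : ℕ) [NeZero L] (a : ZMod L) :
    16 * (a.valMinAbs : ℝ) ^ 2 / (L : ℝ) ^ 2 ≤ 4 * Real.sin (Real.pi * (a.val : ℝ) / L) ^ 2 := by
  -- adapted from SpectralDefectExtinctionTipNoBindingStubGreenBound (greenBound_coord)
  have hL : (0 : ℝ) < L := by exact_mod_cast Nat.pos_of_ne_zero (NeZero.ne L)
  have h1 : 4 * Real.sin (Real.pi * (a.val : ℝ) / L) ^ 2 =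
      2 * (1 - Real.cos (2 * Real.pi / L * (a.valMinAbs : ℝ))) := by
    rw [Real.sin_sq_eq_half_sub, show 2 * (Real.pi * (a.val : ℝ) / L) =
      2 * Real.pi * (a.val : ℝ) / L by ring, latticeSum_cos_two_pi_val_div]
    ring
  have hb := ZMod.valMinAbs_mem_Ioc a
  have hlo : -(L : ℝ) < 2 * (a.valMinAbs : ℝ) := by
    have h : (-(L : ℤ) : ℝ) < ((a.valMinAbs * 2 : ℤ) : ℝ) := by exact_mod_cast hb.1
    push_cast at h
    linarith
  have hhi : 2 * (a.valMinAbs : ℝ) ≤ L := by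
    have h : ((a.valMinAbs * 2 : ℤ) : ℝ) ≤ ((L : ℤ) : ℝ) := by exact_mod_cast hb.2
    push_cast at h
    linarith
  have hθ : |2 * Real.pi / L * (a.valMinAbs : ℝ)| ≤ Real.pi := by
    rw [abs_le]
    constructor
    · rw [div_mul_eq_mul_div, le_div_iff₀ hL]
      nlinarith [Real.pi_pos]
    · rw [div_mul_eq_mul_div, div_le_iff₀ hL]
      nlinarith [Real.pi_pos]
  have hj := Real.cos_le_one_sub_mul_cos_sq hθ
  have heq : 2 * (2 / Real.pi ^ 2 * (2 * Real.pi / L * (a.valMinAbs : ℝ)) ^ 2) =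
      16 * (a.valMinAbs : ℝ) ^ 2 / (L : ℝ) ^ 2 := by
    field_simp
    ring
  rw [h1, ← heq]
  linarith

/-- Doubling the angle: `sin²(2π a.val / L) = sin²(π (a + a).val / L)`, because
`2 a.val = (a + a).val + q L` with `q ∈ ℕ`. -/
private theorem latticeSum_sin_sq_double (L : ℕ) [NeZero L] (a : ZMod L) :
    Real.sin (2 * Real.pi * (a.val : ℝ) / L) ^ 2 =
      Real.sin (Real.pi * ((a + a).val : ℝ) / L) ^ 2 := by
  have hL : (L : ℝ) ≠ 0 := by exact_mod_cast NeZero.ne L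
  have hmd : (a + a).val + L * ((a.val + a.val) / L) = a.val + a.val := by
    rw [ZMod.val_add]; exact Nat.mod_add_div _ _
  set q : ℕ := (a.val + a.val) / L with hq
  have hcast : (a.val : ℝ) + a.val = ((a + a).val : ℝ) + L * q := by exact_mod_cast hmd.symm
  have harg : 2 * Real.pi * (a.val : ℝ) / L = Real.pi * ((a + a).val : ℝ) / L + q * Real.pi :=
    calc 2 * Real.pi * (a.val : ℝ) / L = Real.pi * ((a.val : ℝ) + a.val) / L := by ring
      _ = Real.pi * (((a + a).val : ℝ) + L * q) / L := by rw [hcast]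
      _ = Real.pi * ((a + a).val : ℝ) / L + (q : ℝ) * Real.pi * (L / L) := by ring
      _ = Real.pi * ((a + a).val : ℝ) / L + q * Real.pi := by rw [div_self hL, mul_one]
  rw [harg, Real.sin_add_nat_mul_pi, mul_pow]
  rcases neg_one_pow_eq_or ℝ q with h | h <;> rw [h] <;> norm_num

/-- **Termwise bound**: `1/(4 sin²(2π a/L) + ε/4) ≤ 1/(16 m²/L² + ε/4)` with
`m = |valMinAbs (a + a)|`. -/
private theorem latticeSum_term_le (L : ℕ) [NeZero L] (ε : ℝ) (hε : 0 < ε) (a : ZMod L) :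
    1 / (4 * Real.sin (2 * Real.pi * (a.val : ℝ) / L) ^ 2 + ε / 4) ≤
      1 / (16 * (((a + a).valMinAbs.natAbs : ℕ) : ℝ) ^ 2 / (L : ℝ) ^ 2 + ε / 4) := by
  have hnat : (((a + a).valMinAbs.natAbs : ℕ) : ℝ) ^ 2 = (((a + a).valMinAbs : ℤ) : ℝ) ^ 2 := by
    rw [Nat.cast_natAbs, Int.cast_abs, sq_abs]
  rw [hnat, latticeSum_sin_sq_double]
  apply one_div_le_one_div_of_le (by positivity)
  linarith [latticeSum_jordan L (a + a)]

/-! ### Fibres of `a ↦ |valMinAbs (a + a)|` -/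

/-- If `|valMinAbs (a + a)| = j` then `a.val ∈ {j/2, (j+L)/2, (L−j)/2, (2L−j)/2}`. -/
private theorem latticeSum_val_mem (L : ℕ) [NeZero L] (a : ZMod L) :
    a.val ∈ ({(a + a).valMinAbs.natAbs / 2, ((a + a).valMinAbs.natAbs + L) / 2,
      (L - (a + a).valMinAbs.natAbs) / 2, (2 * L - (a + a).valMinAbs.natAbs) / 2} : Finset ℕ) := by
  have hlt : (a + a).val < L := ZMod.val_lt _
  have hva : a.val < L := ZMod.val_lt a
  have hmd : (a + a).val + L * ((a.val + a.val) / L) = a.val + a.val := by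
    rw [ZMod.val_add]; exact Nat.mod_add_div _ _
  have hq : (a.val + a.val) / L < 2 := Nat.div_lt_of_lt_mul (by omega)
  rw [ZMod.valMinAbs_def_pos]
  simp only [Finset.mem_insert, Finset.mem_singleton]
  generalize (a.val + a.val) / L = q at hmd hq
  generalize (a + a).val = v at hlt hmd
  generalize a.val = n at hva hmd
  interval_cases q
  · simp only [mul_zero, add_zero] at hmd
    split_ifs <;> omega
  · simp only [mul_one] at hmd
    split_ifs <;> omega

/-- Each fibre of `a ↦ |valMinAbs (a + a)|` on `ZMod L` has at most four elements. -/
private theorem latticeSum_fiber_card (L : ℕ) [NeZero L] (j : ℕ) :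
    (Finset.univ.filter fun a : ZMod L => (a + a).valMinAbs.natAbs = j).card ≤ 4 :=
  calc (Finset.univ.filter fun a : ZMod L => (a + a).valMinAbs.natAbs = j).card
      ≤ ({j / 2, (j + L) / 2, (L - j) / 2, (2 * L - j) / 2} : Finset ℕ).card := by
        refine Finset.card_le_card_of_injOn (fun a : ZMod L => a.val) ?_ ?_
        · intro a ha
          have hj : (a + a).valMinAbs.natAbs = j := (Finset.mem_filter.1 (Finset.mem_coe.1 ha)).2
          have hm := latticeSum_val_mem L a
          rw [hj] at hm
          exact hm
        · exact fun a _ b _ h => ZMod.val_injective L h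
    _ ≤ 4 := Finset.card_le_four

/-- Fibre bound: `Σ_a h(|valMinAbs (a + a)|) ≤ 4 Σ_{j ≤ L/2} h(j)` for nonnegative `h`. -/
private theorem latticeSum_sum_fiber_le (L : ℕ) [NeZero L] (h : ℕ → ℝ) (hh : ∀ j, 0 ≤ h j) :
    ∑ a : ZMod L, h ((a + a).valMinAbs.natAbs) ≤ 4 * ∑ j ∈ Finset.range (L / 2 + 1), h j := by
  have hmaps : ∀ a ∈ (Finset.univ : Finset (ZMod L)),
      (a + a).valMinAbs.natAbs ∈ Finset.range (L / 2 + 1) :=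
    fun a _ => Finset.mem_range.2 (Nat.lt_succ_of_le (ZMod.natAbs_valMinAbs_le (a + a)))
  rw [← Finset.sum_fiberwise_of_maps_to' hmaps, Finset.mul_sum]
  refine Finset.sum_le_sum fun j _ => ?_
  rw [Finset.sum_const, nsmul_eq_mul]
  have h4 : ((Finset.univ.filter fun a : ZMod L => (a + a).valMinAbs.natAbs = j).card : ℝ) ≤ 4 := by
    exact_mod_cast latticeSum_fiber_card L j
  exact mul_le_mul_of_nonneg_right h4 (hh j)

/-! ### The one-dimensional sum -/

/-- `Σ_{1 ≤ j < N} 1/(j² + s²) ≤ 3/s` for `s > 0` (head `≤ ⌊s⌋/s²`, tail `≤ 2/(⌊s⌋+1)`). -/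
private theorem latticeSum_one_dim (s : ℝ) (hs : 0 < s) (N : ℕ) :
    ∑ j ∈ Finset.Ico 1 N, 1 / ((j : ℝ) ^ 2 + s ^ 2) ≤ 3 / s := by
  set J₀ : ℕ := ⌊s⌋₊ with hJ₀
  have hJ₀le : (J₀ : ℝ) ≤ s := Nat.floor_le hs.le
  have hJ₀lt : s < (J₀ : ℝ) + 1 := Nat.lt_floor_add_one s
  have hsub : Finset.Ico 1 N ⊆ Finset.Icc 1 J₀ ∪ Finset.Ioo J₀ N := by
    intro j hj
    rw [Finset.mem_Ico] at hj
    rw [Finset.mem_union, Finset.mem_Icc, Finset.mem_Ioo]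
    omega
  have hdisj : Disjoint (Finset.Icc 1 J₀) (Finset.Ioo J₀ N) := by
    rw [Finset.disjoint_left]
    intro j hj hj'
    rw [Finset.mem_Icc] at hj
    rw [Finset.mem_Ioo] at hj'
    omega
  have hhead : ∑ j ∈ Finset.Icc 1 J₀, 1 / ((j : ℝ) ^ 2 + s ^ 2) ≤ 1 / s :=
    calc ∑ j ∈ Finset.Icc 1 J₀, 1 / ((j : ℝ) ^ 2 + s ^ 2)
        ≤ ∑ _j ∈ Finset.Icc 1 J₀, 1 / s ^ 2 := by
          refine Finset.sum_le_sum fun j _ => ?_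
          apply one_div_le_one_div_of_le (by positivity)
          nlinarith [sq_nonneg (j : ℝ)]
      _ = (J₀ : ℝ) * (1 / s ^ 2) := by
          rw [Finset.sum_const, Nat.card_Icc, Nat.add_sub_cancel, nsmul_eq_mul]
      _ ≤ s * (1 / s ^ 2) := by gcongr
      _ = 1 / s := by
          rw [one_div, one_div, sq, mul_inv, ← mul_assoc, mul_inv_cancel₀ hs.ne', one_mul]
  have htail : ∑ j ∈ Finset.Ioo J₀ N, 1 / ((j : ℝ) ^ 2 + s ^ 2) ≤ 2 / s :=
    calc ∑ j ∈ Finset.Ioo J₀ N, 1 / ((j : ℝ) ^ 2 + s ^ 2)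
        ≤ ∑ j ∈ Finset.Ioo J₀ N, ((j : ℝ) ^ 2)⁻¹ := by
          refine Finset.sum_le_sum fun j hj => ?_
          rw [Finset.mem_Ioo] at hj
          have hj1 : (1 : ℝ) ≤ j := by exact_mod_cast (show 1 ≤ j by omega)
          rw [one_div]
          apply inv_anti₀ (by positivity)
          nlinarith
      _ ≤ 2 / ((J₀ : ℝ) + 1) := sum_Ioo_inv_sq_le J₀ N
      _ ≤ 2 / s := div_le_div_of_nonneg_left (by norm_num) hs hJ₀lt.le
  calc ∑ j ∈ Finset.Ico 1 N, 1 / ((j : ℝ) ^ 2 + s ^ 2)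
      ≤ ∑ j ∈ Finset.Icc 1 J₀ ∪ Finset.Ioo J₀ N, 1 / ((j : ℝ) ^ 2 + s ^ 2) :=
        Finset.sum_le_sum_of_subset_of_nonneg hsub fun j _ _ => by positivity
    _ = ∑ j ∈ Finset.Icc 1 J₀, 1 / ((j : ℝ) ^ 2 + s ^ 2) +
          ∑ j ∈ Finset.Ioo J₀ N, 1 / ((j : ℝ) ^ 2 + s ^ 2) := Finset.sum_union hdisj
    _ ≤ 1 / s + 2 / s := add_le_add hhead htail
    _ = 3 / s := by ring

/-- The bulk sum in lattice units: `Σ_{j=1}^{L/2} 1/(16 j²/L² + ε/4) ≤ 3L/(2√ε)`. -/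
private theorem latticeSum_bulk (L : ℕ) [NeZero L] (ε : ℝ) (hε : 0 < ε) :
    ∑ j ∈ Finset.Ico 1 (L / 2 + 1), 1 / (16 * (j : ℝ) ^ 2 / (L : ℝ) ^ 2 + ε / 4) ≤
      3 * L / (2 * Real.sqrt ε) := by
  have hL : (0 : ℝ) < L := by exact_mod_cast Nat.pos_of_ne_zero (NeZero.ne L)
  have hsq : Real.sqrt ε ^ 2 = ε := Real.sq_sqrt hε.le
  have hsp : 0 < Real.sqrt ε := Real.sqrt_pos.2 hε
  have hs : 0 < (L : ℝ) * Real.sqrt ε / 8 := by positivity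
  have hterm : ∀ j : ℕ, 1 / (16 * (j : ℝ) ^ 2 / (L : ℝ) ^ 2 + ε / 4) =
      (L : ℝ) ^ 2 / 16 * (1 / ((j : ℝ) ^ 2 + ((L : ℝ) * Real.sqrt ε / 8) ^ 2)) := by
    intro j
    rw [div_pow, mul_pow, hsq]
    field_simp
    ring
  calc ∑ j ∈ Finset.Ico 1 (L / 2 + 1), 1 / (16 * (j : ℝ) ^ 2 / (L : ℝ) ^ 2 + ε / 4)
      = (L : ℝ) ^ 2 / 16 *
          ∑ j ∈ Finset.Ico 1 (L / 2 + 1), 1 / ((j : ℝ) ^ 2 + ((L : ℝ) * Real.sqrt ε / 8) ^ 2) := by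
        rw [Finset.mul_sum]
        exact Finset.sum_congr rfl fun j _ => hterm j
    _ ≤ (L : ℝ) ^ 2 / 16 * (3 / ((L : ℝ) * Real.sqrt ε / 8)) := by
        gcongr
        exact latticeSum_one_dim _ hs _
    _ = 3 * L / (2 * Real.sqrt ε) := by
        field_simp
        ring

/-- **The one-dimensional bound**: `J = Σ_{a ∈ ℤ/L} 1/(4 sin²(2π a/L) + ε/4) ≤ 16/ε + 6L/√ε`. -/
private theorem latticeSum_J_le (L : ℕ) [NeZero L] (ε : ℝ) (hε : 0 < ε) :
    ∑ a : ZMod L, 1 / (4 * Real.sin (2 * Real.pi * (a.val : ℝ) / L) ^ 2 + ε / 4) ≤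
      16 / ε + 6 * L / Real.sqrt ε := by
  have hL : (0 : ℝ) < L := by exact_mod_cast Nat.pos_of_ne_zero (NeZero.ne L)
  have hsp : 0 < Real.sqrt ε := Real.sqrt_pos.2 hε
  have h1 : ∑ a : ZMod L, 1 / (4 * Real.sin (2 * Real.pi * (a.val : ℝ) / L) ^ 2 + ε / 4) ≤
      ∑ a : ZMod L, 1 / (16 * (((a + a).valMinAbs.natAbs : ℕ) : ℝ) ^ 2 / (L : ℝ) ^ 2 + ε / 4) :=
    Finset.sum_le_sum fun a _ => latticeSum_term_le L ε hε a
  have h2 : ∑ a : ZMod L, 1 / (16 * (((a + a).valMinAbs.natAbs : ℕ) : ℝ) ^ 2 / (L : ℝ) ^ 2 + ε / 4) ≤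
      4 * ∑ j ∈ Finset.range (L / 2 + 1), 1 / (16 * (j : ℝ) ^ 2 / (L : ℝ) ^ 2 + ε / 4) :=
    latticeSum_sum_fiber_le L (fun j : ℕ => 1 / (16 * (j : ℝ) ^ 2 / (L : ℝ) ^ 2 + ε / 4))
      fun j => by positivity
  have h3 : ∑ j ∈ Finset.range (L / 2 + 1), 1 / (16 * (j : ℝ) ^ 2 / (L : ℝ) ^ 2 + ε / 4) =
      4 / ε + ∑ j ∈ Finset.Ico 1 (L / 2 + 1), 1 / (16 * (j : ℝ) ^ 2 / (L : ℝ) ^ 2 + ε / 4) := by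
    rw [Finset.range_eq_Ico, Finset.sum_eq_sum_Ico_succ_bot (Nat.succ_pos (L / 2)), zero_add]
    congr 1
    rw [Nat.cast_zero]
    field_simp
    ring
  have h4 := latticeSum_bulk L ε hε
  calc ∑ a : ZMod L, 1 / (4 * Real.sin (2 * Real.pi * (a.val : ℝ) / L) ^ 2 + ε / 4)
      ≤ 4 * ∑ j ∈ Finset.range (L / 2 + 1), 1 / (16 * (j : ℝ) ^ 2 / (L : ℝ) ^ 2 + ε / 4) :=
        h1.trans h2
    _ = 4 * (4 / ε + ∑ j ∈ Finset.Ico 1 (L / 2 + 1), 1 / (16 * (j : ℝ) ^ 2 / (L : ℝ) ^ 2 + ε / 4)) := by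
        rw [h3]
    _ ≤ 4 * (4 / ε + 3 * L / (2 * Real.sqrt ε)) := by gcongr
    _ = 16 / ε + 6 * L / Real.sqrt ε := by
        field_simp
        ring

/-- **Stub C2c (`stub_latticeSum`, the `d = 4` momentum sum with doublers).**  There is an absolute `K₁`
with `L⁻⁴ Σ_{k ∈ (ℤ/L)⁴} (Σ_μ 4 sin²(2π k_μ/L) + ε)⁻⁴ ≤ K₁ (1/ε² + 1/(ε⁴L⁴))` for all `L ≥ 1`, `ε > 0`.
Proof sketch: with `b_μ = 4 sin²(2π k_μ/L) + ε/4 > 0`, AM–GM twice gives the SEPARABLE bound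
`(Σ_μ b_μ)⁻⁴ ≤ Π_μ b_μ⁻¹ / 256`, so the sum is `≤ L⁻⁴ J⁴/256` with the one-dimensional
`J = Σ_{a ∈ ℤ/L} (4 sin²(2π a/L) + ε/4)⁻¹`; the `≤ 2` zeros of `sin(2πa/L)` give `J ≤ 8/ε + bulk`, and
Jordan's inequality `4 sin²(π w/L) ≥ 16 m²/L²` (`w = 2a mod L`, `m` its centred representative, each
`|m| ≥ 1` hit `≤ 4` times) gives `bulk ≤ 4 L² Σ_{j≥1} (16 j² + εL²/4)⁻¹ ≤ C L min(L, ε^{-1/2}) ≤ 2C L ε^{-1/2}`;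
hence `J/L ≤ 8/(εL) + 2C ε^{-1/2}` and `(J/L)⁴ ≤ 8((8/(εL))⁴ + 16 C⁴ ε⁻²)`. -/
theorem stub_latticeSum :
    ∃ K₁ : ℝ, ∀ (L : ℕ) [NeZero L] (ε : ℝ), 0 < ε →
      (1 / (L : ℝ) ^ 4) * ∑ k : TorusSite 4 L,
          1 / (∑ μ : Fin 4, 4 * Real.sin (2 * Real.pi * ((k μ).val : ℝ) / L) ^ 2 + ε) ^ 4 ≤
        K₁ * (1 / ε ^ 2 + 1 / (ε ^ 4 * (L : ℝ) ^ 4)) := by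
  refine ⟨2048, fun L _ ε hε => ?_⟩
  have hL : (0 : ℝ) < L := by exact_mod_cast Nat.pos_of_ne_zero (NeZero.ne L)
  have hsq : Real.sqrt ε ^ 2 = ε := Real.sq_sqrt hε.le
  have hsp : 0 < Real.sqrt ε := Real.sqrt_pos.2 hε
  have hS4 : Real.sqrt ε ^ 4 = ε ^ 2 :=
    calc Real.sqrt ε ^ 4 = (Real.sqrt ε ^ 2) ^ 2 := by ring
      _ = ε ^ 2 := by rw [hsq]
  -- AM–GM termwise
  have hamgm : ∀ k : TorusSite 4 L,
      1 / (∑ μ : Fin 4, 4 * Real.sin (2 * Real.pi * ((k μ).val : ℝ) / L) ^ 2 + ε) ^ 4 ≤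
        1 / 256 * ∏ μ : Fin 4, 1 / (4 * Real.sin (2 * Real.pi * ((k μ).val : ℝ) / L) ^ 2 + ε / 4) := by
    intro k
    rw [Fin.sum_univ_four, Fin.prod_univ_four]
    exact latticeSum_amgm _ _ _ _ ε (by positivity) (by positivity) (by positivity) (by positivity) hε
  -- separability: `Σ_k Π_μ g(k μ) = (Σ_a g a)⁴`
  have hstep2 : ∑ k : TorusSite 4 L, ∏ μ : Fin 4,
      1 / (4 * Real.sin (2 * Real.pi * ((k μ).val : ℝ) / L) ^ 2 + ε / 4) =
        (∑ a : ZMod L, 1 / (4 * Real.sin (2 * Real.pi * (a.val : ℝ) / L) ^ 2 + ε / 4)) ^ 4 :=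
    (Fintype.sum_pow (fun a : ZMod L =>
      1 / (4 * Real.sin (2 * Real.pi * (a.val : ℝ) / L) ^ 2 + ε / 4)) 4).symm
  have hJ := latticeSum_J_le L ε hε
  calc 1 / (L : ℝ) ^ 4 * ∑ k : TorusSite 4 L,
        1 / (∑ μ : Fin 4, 4 * Real.sin (2 * Real.pi * ((k μ).val : ℝ) / L) ^ 2 + ε) ^ 4
      ≤ 1 / (L : ℝ) ^ 4 * ∑ k : TorusSite 4 L, (1 / 256 * ∏ μ : Fin 4,
          1 / (4 * Real.sin (2 * Real.pi * ((k μ).val : ℝ) / L) ^ 2 + ε / 4)) := by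
        gcongr with k
        exact hamgm k
    _ = 1 / (L : ℝ) ^ 4 * (1 / 256 *
          (∑ a : ZMod L, 1 / (4 * Real.sin (2 * Real.pi * (a.val : ℝ) / L) ^ 2 + ε / 4)) ^ 4) := by
        rw [← Finset.mul_sum, hstep2]
    _ ≤ 1 / (L : ℝ) ^ 4 * (1 / 256 * (16 / ε + 6 * L / Real.sqrt ε) ^ 4) := by gcongr
    _ ≤ 1 / (L : ℝ) ^ 4 * (1 / 256 * (8 * ((16 / ε) ^ 4 + (6 * L / Real.sqrt ε) ^ 4))) := by
        gcongr
        exact latticeSum_add_pow_four _ _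
    _ = 2048 / (ε ^ 4 * (L : ℝ) ^ 4) + 81 / 2 / ε ^ 2 := by
        rw [div_pow, div_pow, mul_pow, hS4]
        field_simp
        ring
    _ ≤ 2048 * (1 / ε ^ 2 + 1 / (ε ^ 4 * (L : ℝ) ^ 4)) := by
        have h1 : 81 / 2 / ε ^ 2 ≤ 2048 / ε ^ 2 :=
          div_le_div_of_nonneg_right (by norm_num) (by positivity)
        have h2 : 2048 * (1 / ε ^ 2 + 1 / (ε ^ 4 * (L : ℝ) ^ 4)) =
            2048 / ε ^ 2 + 2048 / (ε ^ 4 * (L : ℝ) ^ 4) := by ring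
        linarith

end Summit.QuantumFields.QCD.Cruxes.ActionBoundsLowModes.DropTheWilsonSquare
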